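import Summits.KontsevichZagierPeriods.KontsevichZagierPeriods.Theorems.GrothendieckSectorComplementRingJoin
import Summits.KontsevichZagierPeriods.KontsevichZagierPeriods.Theorems.GrothendieckKEAlgIndependent

/-!
# A second unconditional root: `evalP` is injective on `ℤ[K(1/√2), π, MZV words of weights 2, 4]`
# (stub `stub_ringJoinKPi`, line `containment-join` (ring level), crux `Grothendieck.SectorComplement`,
# stmt-KontsevichZagierPeriods-11102)

In the formal period ring `P = FormalRep ⧸ relations` of the Kontsevich–Zagier calculus
(`KZ.FormalPeriodRing`, evaluation `evalP : P →+* ℝ`), Conjecture 1 in kernel form ON A SECTOR is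
injectivity of `evalP` on a subring. The landed glue file
`GrothendieckSectorComplementRingJoin.lean` proves this UNCONDITIONALLY on the π-root ring
`ℤ[ϖ, ⟦ζ(2)⟧, ⟦ζ(4)⟧, ⟦ζ(3,1)⟧, ⟦ζ(2,2)⟧, ⟦ζ(2,1,1)⟧]` (`piRootRing`, Lindemann) and, GIVEN
`H₁ = LemniscaticSectorKernel`, on its join with the lemniscatic ring `ℤ[κ, ε, ϖ]` (`stub_ringJoin`).

This file lands the registered stub `stub_ringJoinKPi` of the line: a SECOND ROOT that needs no
hypothesis at all. Since `K(1/√2) = Γ(1/4)²/(4√π)` (Lawden (4.3.6), tree theorem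
`Lawden1989_eq_4_3_6_holds`) and `π`, `Γ(1/4)` are algebraically independent over `ℚ` (Chudnovsky,
tree theorem `algebraicIndependent_real_pi_gamma_one_quarter`), the pair `(K(1/√2), π)` is
algebraically independent over `ℚ` (`kPiAlgIndependent`, §1); read in `P` this is injectivity of
`evalP` on `ℤ[κ, ϖ]` (`kPiRingKernel`, §2: `evalP ∘ aeval (κ, ϖ) = aeval (K, π)`), and the saturation
lemma (`stub_saturationKernel`, p99032) with one transfer per admissible word class of weight `2`, `4`
(`exists_nsmul_mem_of_wordClass`, p105421) extends it to the subring generated by `κ`, `ϖ` and those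
classes (§3): EVERY polynomial identity with integer coefficients among
`K(1/√2), π, ζ(2), ζ(4), ζ(3,1), ζ(2,2), ζ(2,1,1)` is derivable by the three rules of
Kontsevich–Zagier — unconditionally.

(History: this is the content of proposal p106420 of lead c1, bounced by a gate restart while in
flight and re-proved here from the landed pieces.)

§5 (appended): the third pair — `E(1/√2)`, `π` are algebraically independent over `ℚ`
(`ePiAlgIndependent`: `K` is a root of `X² − 2E·X + π/2` over `ℚ(E, π)` by Legendre's relation, and
`ℚ(E, π)(K) ⊇ ℚ(K, π)` has transcendence degree `2`), hence the `(E(1/√2), π)`-root ring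
`ℤ[ε, ϖ, MZV words of weights 2, 4]` is an unconditional sector too (`ringJoinEPi`): every PAIR from
`{κ, ε, ϖ}` roots an unconditional sector; only the triple needs `H₁` (the Legendre transfer 0280).

References: M. Kontsevich, D. Zagier, *Periods* (2001), §1.2, §4.1; G. V. Chudnovsky,
*Contributions to the theory of transcendental numbers* (1984), Ch. 7 §2 Cor. 2.3; D. F. Lawden,
*Elliptic Functions and Applications* (1989), (4.3.6).
-/

noncomputable section

open MeasureTheory Set IntermediateField
open Literature.Analysis.SpecialFunctions
open Literature.NumberTheory.Transcendental
open Literature.NumberTheory.Transcendental.KZ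
open MvPolynomial (aeval X C)
open Summit.KontsevichZagierPeriods.KontsevichZagierPeriods.Theses.Grothendieck
open Summit.KontsevichZagierPeriods.Grothendieck.GpcLegendreLemniscaticNegative
open Summit.KontsevichZagierPeriods.Grothendieck.LemniscaticSectorGlue
open Summit.KontsevichZagierPeriods.Grothendieck.SectorComplementAmalgamation
open Summit.KontsevichZagierPeriods.MzvKernelInKZ.Negative

namespace Summit.KontsevichZagierPeriods.Grothendieck.SectorComplementRingJoin

/-! ## §1 `K(1/√2)` and `π` are algebraically independent over `ℚ` -/

/-- **`K(1/√2)` and `π` are algebraically independent over `ℚ`.** With `F = ℚ(K, π)`, Lawden's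
(4.3.6) `K = Γ(1/4)²/(4√π)` puts `Γ(1/4)⁴ = 16πK² ∈ F`, so `Γ(1/4)` is algebraic over `F` and
`trdeg_ℚ F = trdeg_ℚ F(π, Γ(1/4)) ≥ 2` by Chudnovsky's theorem (`π`, `Γ(1/4)` algebraically
independent); a pair generating a field of transcendence degree `≥ 2` is algebraically independent.
[cite: Chudnovsky1984, Ch. 7 §2 Corollary 2.3] [cite: Lawden1989, §4.3 (4.3.6)] -/
theorem kPiAlgIndependent : AlgebraicIndependent ℚ ![lemniscaticK, Real.pi] := by
  have hK : lemniscaticK = Real.Gamma (1 / 4) ^ 2 / (4 * Real.sqrt Real.pi) :=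
    Lawden1989_eq_4_3_6_holds
  set l : Fin 2 → ℝ := ![lemniscaticK, Real.pi]
  set S : Set ℝ := Set.range l
  set F : IntermediateField ℚ ℝ := adjoin ℚ S
  have hKF : lemniscaticK ∈ F := subset_adjoin ℚ S ⟨0, rfl⟩
  have hpiF : Real.pi ∈ F := subset_adjoin ℚ S ⟨1, rfl⟩
  -- `Γ(1/4)⁴ = 16 π K² ∈ F`
  have hsqrt : Real.sqrt Real.pi ^ 2 = Real.pi := Real.sq_sqrt Real.pi_pos.le
  have hG4 : Real.Gamma (1 / 4) ^ 4 = 16 * Real.pi * lemniscaticK ^ 2 := by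
    rw [hK, div_pow, mul_pow, hsqrt]
    field_simp
    ring
  have hG4F : Real.Gamma (1 / 4) ^ 4 ∈ F := by
    rw [hG4]
    exact mul_mem (mul_mem (by exact_mod_cast F.natCast_mem 16) hpiF) (pow_mem hKF 2)
  -- `T = {π, Γ(1/4)}` is algebraic over `F`
  set T : Set ℝ := {Real.pi, Real.Gamma (1 / 4)}
  have hTalg : ∀ x ∈ T, IsAlgebraic F x := by
    intro x hx
    rcases hx with rfl | rfl
    · exact isAlgebraic_algebraMap (⟨Real.pi, hpiF⟩ : F)
    · have h4 : IsAlgebraic F (Real.Gamma (1 / 4) ^ 4) :=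
        isAlgebraic_algebraMap (⟨Real.Gamma (1 / 4) ^ 4, hG4F⟩ : F)
      exact h4.of_pow (by norm_num)
  -- Chudnovsky: `2 ≤ trdeg_ℚ ℚ(S ∪ T)`
  have hy : AlgebraicIndependent ℚ ![Real.pi, Real.Gamma (1 / 4)] :=
    algebraicIndependent_real_pi_gamma_one_quarter
  have hyST : ∀ i, (![Real.pi, Real.Gamma (1 / 4)] : Fin 2 → ℝ) i ∈ adjoin ℚ (S ∪ T) := by
    intro i
    refine subset_adjoin ℚ (S ∪ T) (Or.inr ?_)
    fin_cases i
    · exact Or.inl rfl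
    · exact Or.inr rfl
  have h2 := le_trdeg_adjoin_of_algebraicIndependent (S ∪ T) _ hy hyST
  -- transfer to `F = ℚ(S)` and conclude
  rw [Literature.Barriers.Schanuel.trdeg_adjoin_union_eq_of_isAlgebraic_adjoin S T hTalg] at h2
  exact Literature.Barriers.Schanuel.algebraicIndependent_of_le_trdeg_adjoin l h2

/-- The same pair is algebraically independent over `ℤ` (restriction of scalars along `ℤ → ℚ`).
[cite: Chudnovsky1984, Ch. 7 §2 Corollary 2.3] -/
theorem kPiAlgIndependent_int : AlgebraicIndependent ℤ ![lemniscaticK, Real.pi] :=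
  kPiAlgIndependent.restrictScalars (algebraMap ℤ ℚ).injective_int

/-! ## §2 Read in the formal period ring: `evalP` is injective on `ℤ[κ, ϖ]` -/

/-- **`evalP ∘ aeval (κ, ϖ) = aeval (K(1/√2), π)` on `ℤ[x, y]`** for `κ = ⟦[k]⟧` and the class
`ϖ = ⟦[p]⟧` of any representation `p = [ℝ, 1/(1+x²)]` of `π`: both are ring maps `ℤ[x, y] → ℝ`
agreeing on the variables (`evalP ⟦[k]⟧ = value [k] = K(1/√2)`, `kRep_value`; `evalP ⟦[p]⟧ = π`,
`piRep_value`). [Kontsevich–Zagier 2001, §4.1] -/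
theorem evalP_aeval_kPi (p : IntegralRep 1) (hpd : p.domain = univ)
    (hpi : p.integrand = fun x => 1 / (1 + x 0 ^ 2)) (P : MvPolynomial (Fin 2) ℤ) :
    evalP (aeval ![toFormalPeriod (of kRep), toFormalPeriod (of p)] P) =
      aeval ![lemniscaticK, Real.pi] P := by
  have h := MvPolynomial.comp_aeval (R := ℤ)
    ![toFormalPeriod (of kRep), toFormalPeriod (of p)] evalP.toIntAlgHom
  have hP := AlgHom.congr_fun h P
  rw [AlgHom.comp_apply, RingHom.toIntAlgHom_apply] at hP
  rw [hP]
  have hv : (fun i => evalP.toIntAlgHom (![toFormalPeriod (of kRep), toFormalPeriod (of p)] i)) =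
      ![lemniscaticK, Real.pi] := by
    funext i
    fin_cases i
    · simp [kRep_value]
    · simp [piRep_value p hpd hpi]
  rw [hv]

/-- **`evalP` is injective on `ℤ[κ, ϖ]`** (`κ = ⟦[k]⟧`, `ϖ = ⟦[p]⟧`, `p = [ℝ, 1/(1+x²)]`): if
`evalP (aeval (κ, ϖ) P) = 0` then `aeval (K, π) P = 0` (`evalP_aeval_kPi`), hence `P = 0` by the
algebraic independence of `K(1/√2)`, `π` over `ℤ` (`kPiAlgIndependent_int`), hence
`aeval (κ, ϖ) P = 0`. [cite: Chudnovsky1984, Ch. 7 §2 Corollary 2.3] -/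
theorem kPiRingKernel (p : IntegralRep 1) (hpd : p.domain = univ)
    (hpi : p.integrand = fun x => 1 / (1 + x 0 ^ 2)) (P : MvPolynomial (Fin 2) ℤ)
    (hP : evalP (aeval ![toFormalPeriod (of kRep), toFormalPeriod (of p)] P) = 0) :
    aeval ![toFormalPeriod (of kRep), toFormalPeriod (of p)] P = 0 := by
  rw [evalP_aeval_kPi p hpd hpi] at hP
  have hP0 : P = 0 := kPiAlgIndependent_int (by rw [hP, map_zero])
  rw [hP0, map_zero]

/-! ## §3 The registered stub: saturation by the word classes -/

/-- STUB S3b (registered `stub_ringJoinKPi`, line `containment-join`, crux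
stmt-KontsevichZagierPeriods-11102) — **UNCONDITIONAL.** `evalP` is injective on the subring of the
formal period ring generated by `κ = ⟦[k]⟧`, `ϖ = ⟦[p]⟧` (`p = [ℝ, 1/(1+x²)]` any representation of `π`)
and the classes of all admissible MZV word representations of weights `2` and `4`: Conjecture 1 of
Kontsevich–Zagier in kernel form on the ring `ℤ[K(1/√2), π, ζ(2), ζ(4), ζ(3,1), ζ(2,2), ζ(2,1,1)]`,
with no hypothesis. Proof: saturation (`stub_saturationKernel`) over `R₀ = ℤ[κ, ϖ]`, on which `evalP`
is injective by Chudnovsky (`kPiRingKernel`), every word class having a non-zero integer multiple in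
`ℤ[ϖ] ⊆ R₀` (`exists_nsmul_mem_of_wordClass`). [Kontsevich–Zagier 2001, §1.2, §4.1]
[cite: Chudnovsky1984, Ch. 7 §2 Corollary 2.3] -/
theorem stub_ringJoinKPi :
    ∀ (p : IntegralRep 1), p.domain = Set.univ → (p.integrand = fun x => 1 / (1 + x 0 ^ 2)) →
    ∀ x ∈ Subring.closure
        ({toFormalPeriod (of kRep), toFormalPeriod (of p)} ∪
          toFormalPeriod '' (genSetAdm 2 ∪ genSetAdm 4)),
      evalP x = 0 → x = 0 := by
  intro p hpd hpi
  let v : Fin 2 → FormalPeriodRing := ![toFormalPeriod (of kRep), toFormalPeriod (of p)]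
  let R₀ : Subring FormalPeriodRing := (aeval (R := ℤ) v).range.toSubring
  have hR₀ : ∀ x ∈ R₀, evalP x = 0 → x = 0 := by
    rintro x ⟨P, rfl⟩ hx
    exact kPiRingKernel p hpd hpi P hx
  have hX : ∀ i : Fin 2, v i ∈ R₀ := fun i => ⟨X i, by simp⟩
  intro x hx
  refine stub_saturationKernel R₀ _ hR₀ (exists_nsmul_mem_of_wordClass p hpd hpi R₀ (hX 1)) x
    (Subring.closure_mono ?_ hx)
  rintro y (hy | hy)
  · rcases hy with rfl | rfl
    · exact Or.inl (hX 0)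
    · exact Or.inl (hX 1)
  · exact Or.inr hy

/-! ## §4 Corollary at the level of representations -/

/-- **Equal values ⇒ equivalent, on the `(K(1/√2), π)`-root ring — unconditionally.** Two formal
combinations of integral representations whose classes lie in the subring generated by `κ`, `ϖ`
and the admissible word classes of weights `2`, `4`, and which evaluate to the same real number,
differ by a relation of the Kontsevich–Zagier calculus. [Kontsevich–Zagier 2001, §1.2]
[cite: Chudnovsky1984, Ch. 7 §2 Corollary 2.3] -/
theorem sub_mem_relations_of_mem_kPiRootRing (p : IntegralRep 1) (hpd : p.domain = Set.univ)
    (hpi : p.integrand = fun x => 1 / (1 + x 0 ^ 2)) (c d : FormalRep)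
    (hc : toFormalPeriod c ∈ Subring.closure
        ({toFormalPeriod (of kRep), toFormalPeriod (of p)} ∪
          toFormalPeriod '' (genSetAdm 2 ∪ genSetAdm 4)))
    (hd : toFormalPeriod d ∈ Subring.closure
        ({toFormalPeriod (of kRep), toFormalPeriod (of p)} ∪
          toFormalPeriod '' (genSetAdm 2 ∪ genSetAdm 4)))
    (hval : eval c = eval d) : c - d ∈ relations := by
  rw [← toFormalPeriod_eq_iff, ← sub_eq_zero]
  refine stub_ringJoinKPi p hpd hpi _ (Subring.sub_mem _ hc hd) ?_
  rw [map_sub, evalP_toFormalPeriod, evalP_toFormalPeriod, hval, sub_self]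

/-! ## §5 The third pair: `E(1/√2)` and `π` (so every PAIR from `{K, E, π}` is a free root) -/

/-- **`K(1/√2)` is algebraic over `ℚ(E(1/√2), π)`**: by Legendre's relation at the lemniscatic
modulus, `2EK − K² = π/2` (Lawden (3.8.29), tree theorem `Lawden1989_eq_3_8_29_lemniscatic_holds`),
`K` is a root of the monic quadratic `X² − 2E·X + π/2`. [cite: Lawden1989, §3.8 (3.8.29)] -/
theorem isAlgebraic_lemniscaticK_adjoin_E_pi :
    IsAlgebraic (adjoin ℚ (Set.range ![lemniscaticE, Real.pi])) lemniscaticK := by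
  set F : IntermediateField ℚ ℝ := adjoin ℚ (Set.range ![lemniscaticE, Real.pi])
  have hEF : lemniscaticE ∈ F := subset_adjoin ℚ _ ⟨0, rfl⟩
  have hpiF : Real.pi ∈ F := subset_adjoin ℚ _ ⟨1, rfl⟩
  have hL : 2 * lemniscaticE * lemniscaticK - lemniscaticK ^ 2 = Real.pi / 2 :=
    Lawden1989_eq_3_8_29_lemniscatic_holds
  let e : F := ⟨lemniscaticE, hEF⟩
  let q : F := ⟨Real.pi, hpiF⟩
  -- the monic quadratic `X² + (−2E)·X + π/2`
  let f : Polynomial F :=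
    Polynomial.X ^ 2 + (Polynomial.C (-2 * e) * Polynomial.X + Polynomial.C (q / 2))
  have hmonic : f.Monic := by
    refine Polynomial.monic_X_pow_add ?_
    refine (Polynomial.degree_add_le _ _).trans_lt ?_
    refine max_lt ?_ ?_
    · exact (Polynomial.degree_C_mul_X_le _).trans_lt (by exact_mod_cast Nat.lt_succ_self 1)
    · exact (Polynomial.degree_C_le).trans_lt (by exact_mod_cast Nat.succ_pos 1)
  refine isAlgebraic_iff_isIntegral.mpr ⟨f, hmonic, ?_⟩
  simp only [f, e, q, Polynomial.eval₂_add, Polynomial.eval₂_mul, Polynomial.eval₂_pow,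
    Polynomial.eval₂_X, Polynomial.eval₂_C]
  change lemniscaticK ^ 2 + ((-2 * lemniscaticE) * lemniscaticK + Real.pi / 2) = 0
  linarith

/-- **`E(1/√2)` and `π` are algebraically independent over `ℚ`.** `ℚ(E, π)(K) ⊇ ℚ(K, π)` has
transcendence degree `≥ 2` (`kPiAlgIndependent`), and `K` is algebraic over `ℚ(E, π)` (Legendre's
relation), so `trdeg_ℚ ℚ(E, π) ≥ 2`. Together with `keAlgIndependent_proof` (stmt-8611) and
`kPiAlgIndependent`: every pair from `{K(1/√2), E(1/√2), π}` is algebraically independent, while the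
triple satisfies exactly Legendre's relation (Chudnovsky: transcendence degree `2`).
[cite: Chudnovsky1984, Ch. 7 §2 Corollary 2.3] [cite: Lawden1989, §3.8 (3.8.29), §4.3 (4.3.6)] -/
theorem ePiAlgIndependent : AlgebraicIndependent ℚ ![lemniscaticE, Real.pi] := by
  set l : Fin 2 → ℝ := ![lemniscaticE, Real.pi]
  set S : Set ℝ := Set.range l
  set T : Set ℝ := {lemniscaticK}
  have hTalg : ∀ x ∈ T, IsAlgebraic (adjoin ℚ S) x := by
    intro x hx
    rw [Set.mem_singleton_iff] at hx
    subst hx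
    exact isAlgebraic_lemniscaticK_adjoin_E_pi
  have hyST : ∀ i, (![lemniscaticK, Real.pi] : Fin 2 → ℝ) i ∈ adjoin ℚ (S ∪ T) := by
    intro i
    refine subset_adjoin ℚ (S ∪ T) ?_
    fin_cases i
    · exact Or.inr rfl
    · exact Or.inl ⟨1, rfl⟩
  have h2 := le_trdeg_adjoin_of_algebraicIndependent (S ∪ T) _ kPiAlgIndependent hyST
  rw [Literature.Barriers.Schanuel.trdeg_adjoin_union_eq_of_isAlgebraic_adjoin S T hTalg] at h2
  exact Literature.Barriers.Schanuel.algebraicIndependent_of_le_trdeg_adjoin l h2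

/-- The same pair is algebraically independent over `ℤ`. [cite: Chudnovsky1984, Ch. 7 §2 Corollary 2.3] -/
theorem ePiAlgIndependent_int : AlgebraicIndependent ℤ ![lemniscaticE, Real.pi] :=
  ePiAlgIndependent.restrictScalars (algebraMap ℤ ℚ).injective_int

/-- **`evalP ∘ aeval (ε, ϖ) = aeval (E(1/√2), π)` on `ℤ[x, y]`** (`ε = ⟦[e]⟧`, `eRep_value`;
`ϖ = ⟦[p]⟧`, `piRep_value`). [Kontsevich–Zagier 2001, §4.1] -/
theorem evalP_aeval_ePi (p : IntegralRep 1) (hpd : p.domain = univ)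
    (hpi : p.integrand = fun x => 1 / (1 + x 0 ^ 2)) (P : MvPolynomial (Fin 2) ℤ) :
    evalP (aeval ![toFormalPeriod (of eRep), toFormalPeriod (of p)] P) =
      aeval ![lemniscaticE, Real.pi] P := by
  have h := MvPolynomial.comp_aeval (R := ℤ)
    ![toFormalPeriod (of eRep), toFormalPeriod (of p)] evalP.toIntAlgHom
  have hP := AlgHom.congr_fun h P
  rw [AlgHom.comp_apply, RingHom.toIntAlgHom_apply] at hP
  rw [hP]
  have hv : (fun i => evalP.toIntAlgHom (![toFormalPeriod (of eRep), toFormalPeriod (of p)] i)) =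
      ![lemniscaticE, Real.pi] := by
    funext i
    fin_cases i
    · simp [eRep_value]
    · simp [piRep_value p hpd hpi]
  rw [hv]

/-- **`evalP` is injective on `ℤ[ε, ϖ]`.** [cite: Chudnovsky1984, Ch. 7 §2 Corollary 2.3] -/
theorem ePiRingKernel (p : IntegralRep 1) (hpd : p.domain = univ)
    (hpi : p.integrand = fun x => 1 / (1 + x 0 ^ 2)) (P : MvPolynomial (Fin 2) ℤ)
    (hP : evalP (aeval ![toFormalPeriod (of eRep), toFormalPeriod (of p)] P) = 0) :
    aeval ![toFormalPeriod (of eRep), toFormalPeriod (of p)] P = 0 := by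
  rw [evalP_aeval_ePi p hpd hpi] at hP
  have hP0 : P = 0 := ePiAlgIndependent_int (by rw [hP, map_zero])
  rw [hP0, map_zero]

/-- **The `(E(1/√2), π)`-root ring — UNCONDITIONAL.** `evalP` is injective on the subring of the
formal period ring generated by `ε = ⟦[e]⟧`, `ϖ = ⟦[p]⟧` and the classes of all admissible MZV word
representations of weights `2`, `4`: Conjecture 1 in kernel form on
`ℤ[E(1/√2), π, ζ(2), ζ(4), ζ(3,1), ζ(2,2), ζ(2,1,1)]`, no hypothesis. With `stub_ringJoinKPi` and
`stub_ringJoin`: each of the three PAIRS from `{κ, ε, ϖ}` roots an unconditional sector; only the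
triple needs `H₁` (= the Legendre transfer, stmt-0280). [Kontsevich–Zagier 2001, §1.2, §4.1]
[cite: Chudnovsky1984, Ch. 7 §2 Corollary 2.3] -/
theorem ringJoinEPi :
    ∀ (p : IntegralRep 1), p.domain = Set.univ → (p.integrand = fun x => 1 / (1 + x 0 ^ 2)) →
    ∀ x ∈ Subring.closure
        ({toFormalPeriod (of eRep), toFormalPeriod (of p)} ∪
          toFormalPeriod '' (genSetAdm 2 ∪ genSetAdm 4)),
      evalP x = 0 → x = 0 := by
  intro p hpd hpi
  let v : Fin 2 → FormalPeriodRing := ![toFormalPeriod (of eRep), toFormalPeriod (of p)]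
  let R₀ : Subring FormalPeriodRing := (aeval (R := ℤ) v).range.toSubring
  have hR₀ : ∀ x ∈ R₀, evalP x = 0 → x = 0 := by
    rintro x ⟨P, rfl⟩ hx
    exact ePiRingKernel p hpd hpi P hx
  have hX : ∀ i : Fin 2, v i ∈ R₀ := fun i => ⟨X i, by simp⟩
  intro x hx
  refine stub_saturationKernel R₀ _ hR₀ (exists_nsmul_mem_of_wordClass p hpd hpi R₀ (hX 1)) x
    (Subring.closure_mono ?_ hx)
  rintro y (hy | hy)
  · rcases hy with rfl | rfl
    · exact Or.inl (hX 0)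
    · exact Or.inl (hX 1)
  · exact Or.inr hy

end Summit.KontsevichZagierPeriods.Grothendieck.SectorComplementRingJoin

end
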